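import Mathlib

/-!
# NODE O port PT-A — `stub_G3C` helper (leaves (α)(γ), any edition): THE RESUMMATION STEP — from the parametrix identity `A·C₀ = 1 + R` with `‖R‖ < 1` (the `ℓ²`-operator norm) to
# `A` a unit and `A⁻¹ = C₀ · Σ_n (−R)ⁿ` as a convergent (`HasSum`) series ([B9] (3.96) «(Q′G′Q′*)⁻¹ = C₀(I − R)⁻¹ = Σ C₀Rⁿ … the series is convergent»)

Cell `ym-nodeO-ideate`, porter hand `hand-27930-G3C` (g0); proof kind, `--supports stmt-QuantumFields-27930 --as helper` (count-neutral).  [B9] = [Balaban1985BackgroundPropagators].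

WHY.  The walk edition of `Tr (x + T)⁻¹` (`G3C-OBSTRUCTION-v1.md` §5∕§5b) expands `A⁻¹`, `A = x·1 + T`, from ✓`G3CInv.parametrix_identity_oneSided` (`A·C₀ = 1 + R`) once `‖R‖ < 1` (from
✓`…G3CCombesThomas`∕`…G3CResolvent`∕`…G3CStickOut`∕`…G3CPieceSum`): this file is the one-line functional analysis in the `ℓ²`-operator norm on `Matrix ι ι ℂ` (Mathlib's `HasSummableGeomSeries`
for complete normed rings): `A` is a unit, `A⁻¹ = C₀·Σ'(−R)ⁿ`, and the series converges to `A⁻¹` TERMWISE (`HasSum`), which is what the walk resummation (sum over `n` of products of `n` remainder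
factors) consumes; entries and partial traces follow by continuity of evaluation.

WHAT THIS FILE PROVES (sorry-free, generic finite index type, scoped `Matrix.Norms.L2Operator`): `one_add_mul_tsum_neg_pow` (`(1 + R)·Σ'(−R)ⁿ = 1`), `isUnit_det_of_parametrix`,
★ `inv_eq_parametrix_mul_tsum` (`A⁻¹ = C₀·Σ'(−R)ⁿ`), ★ `hasSum_parametrix` (`HasSum (n ↦ C₀(−R)ⁿ) A⁻¹`), `hasSum_parametrix_apply` (entrywise), `hasSum_parametrix_trace_block` (partial traces `Σ_{i∈s}`).

HONEST FRAMING.  Elementary; nothing of Bałaban's asserted, ported or discharged; `stub_G3C` NOT closed (mis-cut verdict stands); 27930 OPEN; NODE O 0∕1; COUNT 8∕28 · K 1∕4 UNMOVED; finite `𝕋⁴` at fixed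
ε — NOT continuum ∕ OS ∕ Clay; **the Yang–Mills mass gap is NOT proved by any of this.**  No `sorry`, no `instance`, no `notation`, no `def`; standard axioms.
-/

noncomputable section

open scoped BigOperators Matrix.Norms.L2Operator
open Finset

namespace Summit.QuantumFields.YangMills.Theorems.BalabanUVNodesPortS1.G3CInv

variable {ι : Type*} [Fintype ι] [DecidableEq ι]

/-- `(1 + R)·Σ'(−R)ⁿ = 1` for `‖R‖ < 1` (geometric series in the complete normed ring `Matrix ι ι ℂ`, `ℓ²`-operator norm). [cite: Balaban1985BackgroundPropagators, (3.96) p.411] -/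
theorem one_add_mul_tsum_neg_pow (R : Matrix ι ι ℂ) (hR : ‖R‖ < 1) : (1 + R) * ∑' n : ℕ, (-R) ^ n = 1 := by
  have h : ‖-R‖ < 1 := by rwa [norm_neg]
  have := mul_neg_geom_series (-R) h
  rwa [sub_neg_eq_add] at this

/-- `Σ'(−R)ⁿ·(1 + R) = 1` for `‖R‖ < 1`. [folklore] -/
theorem tsum_neg_pow_mul_one_add (R : Matrix ι ι ℂ) (hR : ‖R‖ < 1) : (∑' n : ℕ, (-R) ^ n) * (1 + R) = 1 := by
  have h : ‖-R‖ < 1 := by rwa [norm_neg]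
  have := geom_series_mul_neg (-R) h
  rwa [sub_neg_eq_add] at this

/-- **A parametrix makes `A` a unit**: `A·C₀ = 1 + R`, `‖R‖ < 1` ⟹ `IsUnit A.det`. [cite: Balaban1985BackgroundPropagators, (3.96) p.411] -/
theorem isUnit_det_of_parametrix {A C₀ R : Matrix ι ι ℂ} (h : A * C₀ = 1 + R) (hR : ‖R‖ < 1) : IsUnit A.det :=
  Matrix.isUnit_det_of_right_inverse (B := C₀ * ∑' n : ℕ, (-R) ^ n) (by rw [← Matrix.mul_assoc, h, one_add_mul_tsum_neg_pow R hR])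

/-- ★ **RESUMMATION**: `A·C₀ = 1 + R`, `‖R‖ < 1` ⟹ `A⁻¹ = C₀·Σ'(−R)ⁿ`. [cite: Balaban1985BackgroundPropagators, (3.96) p.411, (3.90) p.409] -/
theorem inv_eq_parametrix_mul_tsum {A C₀ R : Matrix ι ι ℂ} (h : A * C₀ = 1 + R) (hR : ‖R‖ < 1) : A⁻¹ = C₀ * ∑' n : ℕ, (-R) ^ n :=
  Matrix.inv_eq_right_inv (by rw [← Matrix.mul_assoc, h, one_add_mul_tsum_neg_pow R hR])

/-- ★ **The series converges to `A⁻¹` termwise**: `HasSum (n ↦ C₀·(−R)ⁿ) A⁻¹`. [cite: Balaban1985BackgroundPropagators, (3.96) p.411] -/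
theorem hasSum_parametrix {A C₀ R : Matrix ι ι ℂ} (h : A * C₀ = 1 + R) (hR : ‖R‖ < 1) : HasSum (fun n : ℕ => C₀ * (-R) ^ n) A⁻¹ := by
  rw [inv_eq_parametrix_mul_tsum h hR]
  have hs : Summable (fun n : ℕ => (-R) ^ n) := summable_geometric_of_norm_lt_one (by rwa [norm_neg])
  exact hs.hasSum.mul_left C₀

/-- Entrywise: `HasSum (n ↦ (C₀·(−R)ⁿ) i j) (A⁻¹ i j)`. [folklore] -/
theorem hasSum_parametrix_apply {A C₀ R : Matrix ι ι ℂ} (h : A * C₀ = 1 + R) (hR : ‖R‖ < 1) (i j : ι) :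
    HasSum (fun n : ℕ => (C₀ * (-R) ^ n) i j) (A⁻¹ i j) :=
  (Pi.hasSum.1 (Pi.hasSum.1 (hasSum_parametrix h hR) i)) j

/-- Partial traces: `HasSum (n ↦ Σ_{i∈s} (C₀·(−R)ⁿ) i i) (Σ_{i∈s} A⁻¹ i i)` (the `𝟙_□`-block traces of the walk edition). [folklore] -/
theorem hasSum_parametrix_trace_block {A C₀ R : Matrix ι ι ℂ} (h : A * C₀ = 1 + R) (hR : ‖R‖ < 1) (s : Finset ι) :
    HasSum (fun n : ℕ => ∑ i ∈ s, (C₀ * (-R) ^ n) i i) (∑ i ∈ s, A⁻¹ i i) :=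
  hasSum_sum fun i _ => hasSum_parametrix_apply h hR i i

/-- Tail∕term size: `‖C₀·(−R)ⁿ‖ ≤ ‖C₀‖·‖R‖ⁿ` (`n ≥ 1`; the per-step factor of the walk bound). [folklore] -/
theorem norm_parametrix_term_le (C₀ R : Matrix ι ι ℂ) {n : ℕ} (hn : 0 < n) : ‖C₀ * (-R) ^ n‖ ≤ ‖C₀‖ * ‖R‖ ^ n := by
  refine (norm_mul_le _ _).trans (mul_le_mul_of_nonneg_left ?_ (norm_nonneg _))
  rw [← norm_neg R]
  exact norm_pow_le' _ hn

end Summit.QuantumFields.YangMills.Theorems.BalabanUVNodesPortS1.G3CInv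

end
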